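import Summits.ResolutionOfSingularities.ResolutionOfSingularities.Theorems.KeyChainLU
import Literature.AlgebraicGeometry.Resolution.EmbeddedLocalUniformization
import HarnessLib

/-!
# KeyChainLU2 — decomp-res node «KeyLadder» (lens-1 g21), tree file 2/5: key-chain local uniformization

Content VERBATIM from the decomp-res lens-1 g21 tree companion `HOME/decomp-res-lens-1/g21/tree/KeyChainLU.lean`
(sha 0edd4007, 1 331 l; = the node
`g21/KeyLadder.lean` a1145436 re-namespaced, typed against the LANDED `Theorems.WCut`, nothing inlined; farm rc 0 ·
0 err · 0 warn · 0 sorry, axioms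
standard; HOME = run/shared/lean/pub/decomp-res).  Critic: CRITIC-LEDGER row 163 (DECIDED +1 · MAP 0: the kernel law
`relLU_of_keyChainTop`, cell
`KeyChainTopBelow`, exact cuts of both `W`-halves; 2026-08-31T01:02:09Z); landing orders INBOX :625 / :633,
`g21/WRITER.md` 82b559ef.  Landed by
decomp-res writer g9 for the lens-1 column (host route `Valuative`, item `LuAlphaPTorsor` stmt-…-0641 — HELPER
files, no route edit) as
`KeyChainLU` / `KeyChainLU2` / … (PARTS I–VI, greedy ≤ 400-line packing, linear imports) and `KeyChainCut` (PART
VII, the split point named in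
WRITER.md); namespace, sections, section variables / opens and every declaration exactly as in the companion (its
one global linter option dropped;
the companion lemma `valuation_algebraMap_eq_one` restated the landed `Literature…ELU.valuation_algebraMap_eq_one` —
gate `dedup.landed` p800231 —
so the copy is dropped and its two uses cite the Literature lemma, import `EmbeddedLocalUniformization` in file 2).

-/

noncomputable section

open IsLocalRing Literature.AlgebraicGeometry.Resolution
open Summit.ResolutionOfSingularities.ResolutionOfSingularities.Theorems

namespace Summit.ResolutionOfSingularities.ResolutionOfSingularities.Theorems.KeyChainLU

section Datum

variable (k : Type) [Field k] {K : Type} [Field K] [Algebra k K] (O : ValuationSubring K)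

/-! ## PART II — the cell datum: inductive binomial key chains over a monomial 3-frame (§2) -/

/-- **Inductive binomial key chain** over a monomial `3`-frame (the typed cell datum).  The single
sequence `g : ℕ → K` packs the frame `y₀, y₁, y₂ := g 0, g 1, g 2`, the top `z := g 3` and the
successive key values `s_j := g (j + 3)` (`s₀ = z`); `e j` is the `j`-th key degree jump, `b j` the
exponent vector of the Laurent monomial `𝔪_j := ∏ g i ^ (b j i)` in `g 0, …, g (j+2)` (i.e. in the
frame and the EARLIER key values), and `ζ j ∈ kˣ` the residue of `s_j ^ e_j / 𝔪_j`; the defining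
recursion is the BINOMIAL KEY RELATION `s_{j+1} = s_j ^ e_j - ζ_j · 𝔪_j`.  See PART 0 §B for the
dictionary with MacLane / Herrera–Olalla–Spivakovsky key polynomials and San Saturnino's complete
families (arXiv:1412.7697, Def. 4.1), whose valuation-theoretic content is the field `complete`. -/
structure IsKeyChain (g : ℕ → K) (e : ℕ → ℕ) (b : ℕ → ℕ →₀ ℤ) (ζ : ℕ → k) : Prop where
  /-- all members of the chain are non-zero … -/
  ne_zero : ∀ i, g i ≠ 0
  /-- … and lie in the valuation ring -/
  le_one : ∀ i, O.valuation (g i) ≤ 1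
  /-- the frame values are `ℤ`-independent (a MONOMIAL frame) … -/
  frame_indep : ∀ m : Fin 3 → ℤ, (∏ i : Fin 3, O.valuation (g i) ^ m i) = 1 → m = 0
  /-- … and span the value group rationally (`rat.rk = 3`: every value is torsion over the frame) -/
  ratrank : ∀ x : K, x ≠ 0 → ∃ E : ℕ, 0 < E ∧ ∃ m : Fin 3 → ℤ,
    O.valuation x ^ E = ∏ i : Fin 3, O.valuation (g i) ^ m i
  /-- `(y₀, y₁, y₂, z)` is a transcendence basis generating `K = k(y, z)` -/
  algInd : AlgebraicIndependent k fun i : Fin 4 => g i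
  adjoin_eq_top : IntermediateField.adjoin k (Set.range fun i : Fin 4 => g i) = ⊤
  /-- key degree jumps are positive -/
  e_pos : ∀ j, 0 < e j
  /-- `𝔪_j` is a monomial in `g 0, …, g (j+2)` -/
  b_lt : ∀ j, ∀ i ∈ (b j).support, i < j + 3
  /-- the BINOMIAL KEY RELATION `s_{j+1} = s_j ^ e_j - ζ_j 𝔪_j` -/
  key : ∀ j, g (j + 4) = g (j + 3) ^ e j - algebraMap k K (ζ j) * (b j).prod fun i m => g i ^ m
  /-- KEY CONDITION: `v (s_j ^ e_j) = v 𝔪_j` … -/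
  key_val : ∀ j, O.valuation (g (j + 3) ^ e j) = O.valuation ((b j).prod fun i m => g i ^ m)
  /-- … RESIDUE CONDITION: `ζ_j` is the residue of `s_j ^ e_j / 𝔪_j`, i.e. the value JUMPS -/
  res_val : ∀ j, O.valuation (g (j + 4)) < O.valuation ((b j).prod fun i m => g i ^ m)
  /-- MINIMALITY of `e_j`: no smaller power of `s_j` has a value in the lattice of the earlier ones -/
  minimal : ∀ j (e' : ℕ), 0 < e' → e' < e j → ∀ γ : ℕ →₀ ℤ, (∀ i ∈ γ.support, i < j + 3) →
    O.valuation (g (j + 3) ^ e') ≠ O.valuation (γ.prod fun i m => g i ^ m)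
  /-- COMPLETENESS (San Saturnino 2017, Def. 4.1, monomial form): every non-zero polynomial in
  `y, z` is a `k`-combination of Laurent monomials in the chain with NO CANCELLATION of values -/
  complete : ∀ a ∈ Algebra.adjoin k (Set.range fun i : Fin 4 => g i), a ≠ 0 →
    ∃ (N : ℕ) (c : Fin N → k) (β : Fin N → ℕ →₀ ℤ),
      a = ∑ t, algebraMap k K (c t) * (β t).prod (fun i m => g i ^ m) ∧
      ∀ t, O.valuation (algebraMap k K (c t) * (β t).prod fun i m => g i ^ m) ≤ O.valuation a

/-- **The decided cell** `KeyChainTopBelow k O`: `(K, O)` carries an inductive binomial key chain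
over a monomial `3`-frame (`IsKeyChain`). -/
def KeyChainTopBelow : Prop :=
  ∃ (g : ℕ → K) (e : ℕ → ℕ) (b : ℕ → ℕ →₀ ℤ) (ζ : ℕ → k), IsKeyChain k O g e b ζ

end Datum

section LemmaU

variable {k : Type} [Field k] {K : Type} [Field K] [Algebra k K] {O : ValuationSubring K}
variable {g : ℕ → K} {e : ℕ → ℕ} {b : ℕ → ℕ →₀ ℤ} {ζ : ℕ → k}

/-! ## PART III — LEMMA U: the unit monomials of a key chain (§3) -/

/-- `Z_j := s_j ^ e_j / 𝔪_j`, the `j`-th unit of the chain (`v Z_j = 1`, residue `ζ_j`). -/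
def Zee (g : ℕ → K) (e : ℕ → ℕ) (b : ℕ → ℕ →₀ ℤ) (j : ℕ) : K := g (j + 3) ^ e j / mon g (b j)

/-- `IsKeyChain.valuation_Zee`: Auxiliary step of the key-chain calculus, VERBATIM from the lens-1 g21 companion
(see the module docstring); the statement is its type. [folklore] -/
theorem IsKeyChain.valuation_Zee (hK : IsKeyChain k O g e b ζ) (j : ℕ) :
    O.valuation (Zee g e b j) = 1 := by
  unfold Zee
  rw [map_div₀, hK.key_val j]
  exact div_self ((Valuation.ne_zero_iff _).mpr (mon_ne_zero hK.ne_zero _))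

/-- `IsKeyChain.Zee_ne_zero`: Auxiliary step of the key-chain calculus, VERBATIM from the lens-1 g21 companion (see
the module docstring); the statement is its type. [folklore] -/
theorem IsKeyChain.Zee_ne_zero (hK : IsKeyChain k O g e b ζ) (j : ℕ) : Zee g e b j ≠ 0 := by
  intro h
  have := hK.valuation_Zee j
  rw [h, map_zero] at this
  exact zero_ne_one this

/-- `IsKeyChain.pow_eq_Zee_mul`: Auxiliary step of the key-chain calculus, VERBATIM from the lens-1 g21 companion
(see the module docstring); the statement is its type. [folklore] -/
theorem IsKeyChain.pow_eq_Zee_mul (hK : IsKeyChain k O g e b ζ) (j : ℕ) :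
    g (j + 3) ^ e j = Zee g e b j * mon g (b j) := by
  unfold Zee
  rw [div_mul_cancel₀ _ (mon_ne_zero hK.ne_zero _)]

/-- `Z_j - ζ_j = s_{j+1} / 𝔪_j`. [folklore] -/
theorem IsKeyChain.Zee_sub (hK : IsKeyChain k O g e b ζ) (j : ℕ) :
    Zee g e b j - algebraMap k K (ζ j) = g (j + 4) / mon g (b j) := by
  rw [eq_div_iff (mon_ne_zero hK.ne_zero _), sub_mul, ← hK.pow_eq_Zee_mul, hK.key j]
  rfl

/-- `IsKeyChain.valuation_Zee_sub_lt`: Auxiliary step of the key-chain calculus, VERBATIM from the lens-1 g21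
companion (see the module docstring); the statement is its type. [folklore] -/
theorem IsKeyChain.valuation_Zee_sub_lt (hK : IsKeyChain k O g e b ζ) (j : ℕ) :
    O.valuation (Zee g e b j - algebraMap k K (ζ j)) < 1 := by
  rw [hK.Zee_sub, map_div₀, div_lt_one₀ (((Valuation.pos_iff _).mpr (mon_ne_zero hK.ne_zero _)))]
  exact hK.res_val j

/-- `IsKeyChain.zeta_ne_zero`: Auxiliary step of the key-chain calculus, VERBATIM from the lens-1 g21 companion (see
the module docstring); the statement is its type. [folklore] -/
theorem IsKeyChain.zeta_ne_zero (hK : IsKeyChain k O g e b ζ) (j : ℕ) : ζ j ≠ 0 := by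
  intro h
  have hlt := hK.res_val j
  rw [hK.key j, h, map_zero, zero_mul, sub_zero, hK.key_val j] at hlt
  exact lt_irrefl _ hlt

/-- **LEMMA U.**  A Laurent monomial of level `n + 3` (i.e. in the frame and `s₀, …, s_{n-1}`) of
value `1` is a Laurent monomial in the units `Z₀, …, Z_{n-1}`.  (Induction on `n`; the Euclidean
division of the top exponent by `e_{n}` has remainder `0` by MINIMALITY, and the base case is the
`ℤ`-independence of the frame values.) [folklore] -/
theorem IsKeyChain.lemmaU (hK : IsKeyChain k O g e b ζ) (n : ℕ) :
    ∀ β : ℕ →₀ ℤ, Bdd (n + 3) β → O.valuation (mon g β) = 1 →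
      ∃ c : ℕ →₀ ℤ, Bdd n c ∧ mon g β = mon (Zee g e b) c := by
  have hg := hK.ne_zero
  induction n with
  | zero =>
    intro β hβ hv
    have hβ0 : β = 0 := by
      have hprod := valuation_mon_eq_prod_fin O g hβ
      have h0 := hK.frame_indep (fun i => β i) (by rw [← hprod]; exact hv)
      ext i
      by_cases hi : i < 3
      · exact congr_fun h0 ⟨i, hi⟩
      · by_contra h
        exact hi (hβ i (Finsupp.mem_support_iff.mpr h))
    exact ⟨0, bdd_zero 0, by rw [hβ0, mon_zero_index, mon_zero_index]⟩
  | succ n ih =>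
    intro β hβ hv
    -- Euclidean division of the top exponent by `e n`
    set m : ℤ := β (n + 3) with hmdef
    set E : ℤ := (e n : ℤ) with hEdef
    have hE : 0 < E := by rw [hEdef]; exact_mod_cast hK.e_pos n
    set q : ℤ := m / E with hqdef
    set r : ℤ := m % E with hrdef
    have hr0 : 0 ≤ r := Int.emod_nonneg _ hE.ne'
    have hrE : r < E := Int.emod_lt_of_pos _ hE
    have hm : m = E * q + r := (Int.mul_ediv_add_emod m E).symm
    -- `β = β₁ + m • δ_{n+3}` with `β₁` of level `n + 3`
    set β₁ : ℕ →₀ ℤ := β.erase (n + 3) with hβ₁def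
    have hβ₁ : Bdd (n + 3) β₁ := by
      intro i hi
      rw [hβ₁def, Finsupp.support_erase, Finset.mem_erase] at hi
      have := hβ i hi.2
      omega
    have hdec : β = β₁ + Finsupp.single (n + 3) m := by
      rw [hβ₁def, hmdef, Finsupp.erase_add_single]
    set β' : ℕ →₀ ℤ := β₁ + q • b n with hβ'def
    have hβ' : Bdd (n + 3) β' := bdd_add hβ₁ (bdd_intSMul q (hK.b_lt n))
    have hmon : mon g β = Zee g e b n ^ q * (mon g β' * g (n + 3) ^ r) := by
      rw [hdec, mon_add hg, mon_single, hm, zpow_add₀ (hg _), zpow_mul, zpow_natCast,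
        hK.pow_eq_Zee_mul, mul_zpow, hβ'def, mon_add hg, mon_intSMul hg]
      ring
    have hv' : O.valuation (mon g β' * g (n + 3) ^ r) = 1 := by
      have h := hv
      rwa [hmon, map_mul, map_zpow₀, hK.valuation_Zee, one_zpow, one_mul] at h
    -- the remainder vanishes, by MINIMALITY of `e n`
    have hr : r = 0 := by
      by_contra hrne
      have h1 : 0 < r.toNat := by omega
      have h2 : r.toNat < e n := by omega
      apply hK.minimal n r.toNat h1 h2 (-β') (bdd_neg hβ')
      show O.valuation (g (n + 3) ^ r.toNat) = O.valuation (mon g (-β'))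
      rw [mon_neg hg, map_inv₀, ← zpow_natCast, Int.toNat_of_nonneg hr0, map_zpow₀]
      rw [map_mul, map_zpow₀] at hv'
      exact eq_inv_of_mul_eq_one_right hv'
    rw [hr, zpow_zero, mul_one] at hmon hv'
    obtain ⟨c', hc', hc'eq⟩ := ih β' hβ' hv'
    refine ⟨c' + Finsupp.single n q, bdd_add (bdd_mono (Nat.le_succ n) hc')
      (bdd_single (Nat.lt_succ_self n) q), ?_⟩
    rw [hmon, hc'eq, mon_add hK.Zee_ne_zero, mon_single, mul_comm]

end LemmaU

section Chart

variable {k : Type} [Field k] {K : Type} [Field K] [Algebra k K] {O : ValuationSubring K}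
variable {g : ℕ → K} {e : ℕ → ℕ} {b : ℕ → ℕ →₀ ℤ} {ζ : ℕ → k}

/-! ## PART IV — the Perron–Zariski chart of a key chain at a level (§4) -/

/-- additive form of `ratrank`: every generator value is torsion modulo the frame lattice [folklore] -/
theorem IsKeyChain.exists_smul_uval_mem (hK : IsKeyChain k O g e b ζ) (i : ℕ) :
    ∃ E : ℕ, 0 < E ∧ (E : ℤ) • uval O (g i) (hK.ne_zero i) ∈ VL O g hK.ne_zero 3 := by
  have hg := hK.ne_zero
  obtain ⟨E, hE, m, hm⟩ := hK.ratrank (g i) (hg i)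
  refine ⟨E, hE, ?_⟩
  have h : (E : ℤ) • uval O (g i) (hg i) = ∑ l : Fin 3, m l • uval O (g l) (hg l) := by
    apply Additive.toMul.injective
    ext
    rw [toMul_zsmul, toMul_sum, Units.val_zpow_eq_zpow_val, val_toMul_uval, zpow_natCast, hm,
      Units.coe_prod]
    refine Finset.prod_congr rfl fun l _ => ?_
    rw [toMul_zsmul, Units.val_zpow_eq_zpow_val, val_toMul_uval]
  rw [h]
  exact Submodule.sum_mem _ fun l _ => Submodule.smul_mem _ _ (Submodule.subset_span ⟨l, rfl⟩)

/-- **RANK.** The value lattice of any level has rank `≤ 3` (it is torsion over the frame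
lattice, which is generated by `3` values). [folklore] -/
theorem IsKeyChain.finrank_VL_le (hK : IsKeyChain k O g e b ζ) (N : ℕ) :
    Module.finrank ℤ (VL O g hK.ne_zero N) ≤ 3 := by
  classical
  have hg := hK.ne_zero
  set V₀ := VL O g hg 3 with hV₀
  choose E hEpos hEmem using hK.exists_smul_uval_mem
  set M : ℕ := ∏ i : Fin N, E i with hMdef
  have hMpos : 0 < M := Finset.prod_pos fun i _ => hEpos i
  have hgen : ∀ i : Fin N, (M : ℤ) • uval O (g i) (hg i) ∈ V₀ := by
    intro i
    have hsplit : M = E i * ∏ j ∈ Finset.univ.erase i, E j :=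
      (Finset.mul_prod_erase Finset.univ (fun j : Fin N => E j) (Finset.mem_univ i)).symm
    rw [hsplit, Nat.cast_mul, mul_comm, mul_smul]
    exact Submodule.smul_mem _ _ (hEmem i)
  have hsub : ∀ x ∈ VL O g hg N, (M : ℤ) • x ∈ V₀ := by
    intro x hx
    refine Submodule.span_induction (p := fun x _ => (M : ℤ) • x ∈ V₀) ?_ ?_ ?_ ?_ hx
    · rintro _ ⟨i, rfl⟩
      exact hgen i
    · rw [smul_zero]
      exact Submodule.zero_mem _
    · intro x y _ _ hx hy
      rw [smul_add]
      exact Submodule.add_mem _ hx hy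
    · intro a x _ hx
      rw [smul_comm]
      exact Submodule.smul_mem _ a hx
  let ψ : VL O g hg N →ₗ[ℤ] V₀ :=
    { toFun := fun x => ⟨(M : ℤ) • (x : Additive (O.ValueGroup)ˣ), hsub x x.2⟩
      map_add' := fun x y => by
        ext
        simp [smul_add]
      map_smul' := fun a x => by
        ext
        simp [smul_comm (M : ℤ) a] }
  have hψ : Function.Injective ψ := by
    intro x y hxy
    have h1 : (M : ℤ) • ((x : Additive (O.ValueGroup)ˣ) - y) = 0 := by
      have := congrArg Subtype.val hxy
      simp only [ψ, LinearMap.coe_mk, AddHom.coe_mk] at this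
      rw [smul_sub, this, sub_self]
    rcases smul_eq_zero.mp h1 with h | h
    · exact absurd h (by exact_mod_cast hMpos.ne')
    · exact Subtype.ext (sub_eq_zero.mp h)
  calc Module.finrank ℤ (VL O g hg N) ≤ Module.finrank ℤ V₀ :=
        LinearMap.finrank_le_finrank_of_injective hψ
    _ ≤ Fintype.card (Fin 3) := finrank_range_le_card _
    _ = 3 := Fintype.card_fin 3

/-- **THE CHART.**  At level `n + 3`, given finitely many Laurent monomials `d ∈ D` of value
`≤ 1`, there are `r ≤ 3` Laurent monomials `Y′_t := g ^ (Y t)` of value `< 1` (a positive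
`ℤ`-basis of the value lattice, Perron–Zariski: `exists_basis_lt_one_of_injective`) such that every
`d ∈ D` is HONESTLY `g ^ d = ∏ Y′_t ^ c_t · (Laurent monomial in the units Z₀ … Z_{n-1})` with
`c_t ∈ ℕ` (LEMMA U supplies the unit part). [folklore] -/
theorem IsKeyChain.exists_chart (hK : IsKeyChain k O g e b ζ) (n : ℕ) (D : Finset (ℕ →₀ ℤ))
    (hD : ∀ d ∈ D, Bdd (n + 3) d ∧ O.valuation (mon g d) ≤ 1) :
    ∃ (r : ℕ) (Y : Fin r → ℕ →₀ ℤ), r ≤ 3 ∧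
      (∀ t, Bdd (n + 3) (Y t) ∧ O.valuation (mon g (Y t)) < 1) ∧
      ∀ d ∈ D, ∃ (c : Fin r → ℕ) (u : ℕ →₀ ℤ), Bdd n u ∧
        mon g d = (∏ t, mon g (Y t) ^ c t) * mon (Zee g e b) u := by
  classical
  have hg := hK.ne_zero
  set V := VL O g hg (n + 3) with hVdef
  let emb : D → V := fun d => ⟨ell O g hg d.1, ell_mem_VL hg (hD d.1 d.2).1⟩
  set D' : Finset V := Finset.univ.image emb with hD'def
  have hD' : ∀ x ∈ D', Additive.toMul (V.subtype.toAddMonoidHom x) ≤ 1 := by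
    intro x hx
    obtain ⟨d, -, rfl⟩ := Finset.mem_image.mp hx
    exact (toMul_ell_le_one_iff hg d.1).mpr (hD d.1 d.2).2
  obtain ⟨eB, heB, -, hrep⟩ := exists_basis_lt_one_of_injective (V := V) (Γ := (O.ValueGroup)ˣ)
    V.subtype.toAddMonoidHom Subtype.val_injective D' hD'
  have hY : ∀ t : Fin (Module.finrank ℤ V), ∃ Y : ℕ →₀ ℤ, Bdd (n + 3) Y ∧
      ell O g hg Y = (eB t : Additive (O.ValueGroup)ˣ) :=
    fun t => exists_bdd_ell_eq hg (eB t).2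
  choose Y hYb hYe using hY
  refine ⟨Module.finrank ℤ V, Y, hK.finrank_VL_le (n + 3), fun t => ⟨hYb t, ?_⟩, fun d hd => ?_⟩
  · rw [← toMul_ell_lt_one_iff hg, hYe]
    exact heB t
  · obtain ⟨c, hc⟩ := hrep (emb ⟨d, hd⟩) (Finset.mem_image_of_mem emb (Finset.mem_univ _))
    have hc' : ell O g hg d = ∑ t, (c t : ℤ) • ell O g hg (Y t) := by
      have h := congrArg Subtype.val hc
      simp only [emb, Submodule.coe_sum, Submodule.coe_smul_of_tower] at h
      rw [h]
      refine Finset.sum_congr rfl fun t _ => ?_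
      rw [hYe, natCast_zsmul]
    set δ : ℕ →₀ ℤ := d - ∑ t, (c t : ℤ) • Y t with hδdef
    have hδb : Bdd (n + 3) δ :=
      bdd_sub (hD d hd).1 (bdd_finset_sum _ fun t _ => bdd_intSMul _ (hYb t))
    have hδv : O.valuation (mon g δ) = 1 := by
      rw [← ell_eq_zero_iff hg, hδdef, map_sub, map_sum]
      simp_rw [map_zsmul]
      rw [hc', sub_self]
    obtain ⟨u, hub, hu⟩ := hK.lemmaU n δ hδb hδv
    refine ⟨c, u, hub, ?_⟩
    have hd' : d = (∑ t, (c t : ℤ) • Y t) + δ := by rw [hδdef, add_sub_cancel]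
    rw [hd', mon_add hg, hu, mon_finset_sum hg]
    refine congrArg (· * _) (Finset.prod_congr rfl fun t _ => ?_)
    rw [mon_intSMul hg, zpow_natCast]

end Chart

section Model

variable {k : Type} [Field k] {K : Type} [Field K] [Algebra k K] {O : ValuationSubring K}

/-! ## PART V — the regular affine model `T = k[Y′, Z^{±1}]` of a key chain (§5) -/

/-- `k[S] ⊆ O` as soon as `k ⊆ O` and `S ⊆ O`. [folklore] -/
theorem adjoin_toSubring_le (hk : ∀ c : k, algebraMap k K c ∈ O) {S : Set K}
    (hS : ∀ x ∈ S, x ∈ O) : (Algebra.adjoin k S).toSubring ≤ O.toSubring := by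
  let Oalg : Subalgebra k K := { O.toSubring with algebraMap_mem' := hk }
  have h : Algebra.adjoin k S ≤ Oalg := Algebra.adjoin_le hS
  exact fun x hx => h hx

/-- `mem_centreIdeal_iff`: Auxiliary step of the key-chain calculus, VERBATIM from the lens-1 g21 companion (see the
module docstring); the statement is its type. [folklore] -/
theorem mem_centreIdeal_iff (T : Subalgebra k K) (hTO : T.toSubring ≤ O.toSubring) (x : T) :
    x ∈ centreIdeal T O hTO ↔ O.valuation (x : K) < 1 := by
  unfold centreIdeal
  rw [Ideal.mem_comap, ValuationSubring.valuation_lt_one_iff]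
  rfl

/-- `trdeg_k K = 4` for a key chain. [folklore] -/
theorem trdeg_eq_four {g : ℕ → K} (hind : AlgebraicIndependent k fun i : Fin 4 => g i)
    (htop : IntermediateField.adjoin k (Set.range fun i : Fin 4 => g i) = ⊤) :
    Algebra.trdeg k K = 4 := by
  set w : Fin 4 → K := fun i => g i
  haveI hfr : IsFractionRing (Algebra.adjoin k (Set.range w)) K := by
    have h := (IntermediateField.algebra_adjoin_le_adjoin k (Set.range w) :
      Algebra.adjoin k (Set.range w) ≤ (IntermediateField.adjoin k (Set.range w)).toSubalgebra)
    refine IsFractionRing.of_field _ K fun z => ?_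
    have hz : z ∈ IntermediateField.adjoin k (Set.range w) := by rw [htop]; trivial
    rw [IntermediateField.mem_adjoin_iff_div] at hz
    obtain ⟨a, ha, c, hc, rfl⟩ := hz
    exact ⟨⟨a, ha⟩, ⟨c, hc⟩, rfl⟩
  haveI : Algebra.IsAlgebraic (Algebra.adjoin k (Set.range w)) K :=
    IsLocalization.isAlgebraic K (nonZeroDivisors (Algebra.adjoin k (Set.range w)))
  have hB : IsTranscendenceBasis k w := hind.isTranscendenceBasis_iff_isAlgebraic.mpr inferInstance
  have := hB.cardinalMk_eq_trdeg
  rw [Cardinal.mk_fin] at this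
  exact_mod_cast this.symm

variable {g : ℕ → K} {e : ℕ → ℕ} {b : ℕ → ℕ →₀ ℤ} {ζ : ℕ → k}

/-- the generators `Y′_t, Z_l, Z_l⁻¹ (l < n)` of the model -/
def gen (g : ℕ → K) (e : ℕ → ℕ) (b : ℕ → ℕ →₀ ℤ) (n : ℕ) {r : ℕ} (Y' : Fin r → K) :
    Fin r ⊕ (Fin n ⊕ Fin n) → K :=
  Sum.elim Y' (Sum.elim (fun l => Zee g e b l) fun l => (Zee g e b l)⁻¹)

variable (k) in
/-- the model `T := k[Y′, Z, Z⁻¹]` -/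
def model (g : ℕ → K) (e : ℕ → ℕ) (b : ℕ → ℕ →₀ ℤ) (n : ℕ) {r : ℕ} (Y' : Fin r → K) :
    Subalgebra k K :=
  Algebra.adjoin k (Set.range (gen g e b n Y'))

/-- «honest monomial»: `∏ Y′_t ^ c_t · Z ^ u` with `c_t ∈ ℕ` and `u` of level `n` -/
def Honest (g : ℕ → K) (e : ℕ → ℕ) (b : ℕ → ℕ →₀ ℤ) (n : ℕ) {r : ℕ} (Y' : Fin r → K) (x : K) :
    Prop :=
  ∃ (c : Fin r → ℕ) (u : ℕ →₀ ℤ), Bdd n u ∧ x = (∏ t, Y' t ^ c t) * mon (Zee g e b) u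

end Model

end Summit.ResolutionOfSingularities.ResolutionOfSingularities.Theorems.KeyChainLU
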